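import Summits.BirchSwinnertonDyer.BirchSwinnertonDyer.Theorems.SignedLowerHalvesKobayashiMainConjectureSmallImageHeckePrimeMuPrelims
import HarnessLib

/-!
# Route `SignedLowerHalves`, crux `KobayashiMainConjectureSmallImage` (item stmt-BirchSwinnertonDyer-19002),
# line `birth_acns`, stub `stub_muOneSign_ns_three`: **the one-sign μ-rider REDUCED TO GROUP THEORY OF `Γ₀(N)`** —
# LEMMA′(N,p) ⇒ some plus symbol `[a/p^k]⁺_f` is a `p`-adic unit (THEOREM B of `EG-REDUCTION-g8`), hence at `p = 3`
# LEMMA′(N,3) ⇒ `min(μ(L₃⁺), μ(L₃⁻)) = 0` (THEOREM A) (cell `bsd-ssimc`, seat `bsd-line-slh-p3` gen 8; THEOREMS ONLY; helper)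

WHAT. `f` a rational weight-2 newform of level `N` (`IsNewform0 f`, `coeffField f = ⊥`), `p` an odd prime, `p ∤ N`, `a_p(f) = 0`.
**LEMMA′(N,p)** (HYPOTHESIS `hLemma`, pure group theory of `Γ₀(N)`): every homomorphism `ψ : Γ₀(N) → ℤ/p` which kills
`S_p = {γ ∈ Γ₀(N) : d(γ) = ±p^k}` is of the form `γ ↦ χ(d(γ) mod N)` for a homomorphism `χ : (ℤ/N)ˣ → ℤ/p` trivial on
`p mod N` (the ideator bsd-idea-13 g8's LEMMA′, `Cruxes/KobayashiMainConjectureSmallImage/EG-REDUCTION-g8.md` §1–3: `Γ′ = ⟨S_p⟩`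
from Venkataramana 1994 Thm. p. 194 / Vaserstein 1972 [finite index of `⟨U(𝔮),V(𝔮)⟩` in `SL₂(ℤ[1/p])`], Mennicke 1967 /
Serre 1970 [CSP for `SL₂(ℤ[1/p])`], the kernel-checked coset lemma `EGCosetLemma.lean` and the transversality facts T±/S/V —
a paper proof, to be typed; NOT assumed as a Literature fact here, only as an explicit hypothesis).
**CONCLUSION** (`exists_norm_ratPlusSymbol_eq_one_of_lemmaPrime`): some `[a/p^k]⁺_f` (`k ≥ 1`, `p ∤ a`; lattice period
`Ω⁺_f`) has `p`-adic norm `1` — i.e. NOT all `p`-power plus symbols vanish mod `p` (THEOREM B, ω⁰-free form); unit-residue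
form `exists_unit_norm_ratPlusSymbol_eq_one_of_lemmaPrime` (`∃ n, ∃ u ∈ (ℤ/p^{n+1})ˣ, ‖[u/p^{n+1}]⁺‖ = 1`), newform-of-a-curve
form `…_of_isNewformOf`, and at `p = 3` (`exists_sign_hasUnitContent_three_of_lemmaPrime`, with the landed
`SmallImageOrbitSumMuThree.exists_sign_hasUnitContent_three_of_norm_ratPlusSymbol_eq_one`, p636964): **LEMMA′(N,3) ⇒
`∃ ε L, IsSignedPAdicLFunction f 3 ε L ∧ HasUnitContent L`** = THEOREM A = `stub_muOneSign_ns_three` of line v6 modulo LEMMA′.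

PROOF (EG-REDUCTION-g8 §4.2–4.4, re-run on the tree's period homology; everything below is PROVED here from tree theorems).
Suppose every `[a/p^k]⁺` (`k ≥ 1`, `p ∤ a`) has norm `< 1` (they are `p`-integral: Eisenstein number `−(p+1)`,
`norm_ratPlusSymbol_le_one`). (i) `re Λ_f = ℤ·Ω⁺/2` (`realPeriods_eq_zmultiples_of_plusPeriod_ne_zero`, `Ω⁺ > 0` by
`IsNewform0.plusPeriod_pos_holds`) gives integers `k_γ` with `re {∞, γ∞}_f = k_γ Ω⁺/2`, additive in `γ` (Manin,
`cuspSymbol_mul_holds`). (ii) For a cusp `B/D`, `gcd(D, BN) = 1`, the Bézout matrix `γ = (u, B; −vN, D) ∈ Γ₀(N)` has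
`d(γ) = D` and `{∞, B/D} = {∞, γ∞} + {∞, 0}` (`modularSymbol_gamma0_smul_holds`), so `2([B/D]⁺ − [0]⁺) = k_γ` (real
coefficients: `plusSymbol_eq_re_holds`, `ratCast_ratPlusSymbol_holds`). (iii) Hecke at `r = 0` with `a_p = 0`
(`intCast_mul_ratPlusSymbol`): `2[0]⁺ = −Σ_{0<j<p}[j/p]⁺`, so `‖[0]⁺‖ < 1` (ultrametric) and `K₀ := 2(p+1)[0]⁺ ∈ pℤ`.
(iv) `ψ := k mod p` kills `S_p`: for `d(γ) = ±p^k`, `γ·0 = b/d` with `p ∤ b` (`isCoprime_col`), so `k_γ = 2([b/d]⁺ − [0]⁺) ≡ 0`.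
(v) LEMMA′ gives `χ`. (vi) For a unit `u` of `ℤ/N` pick `D ≡ u`, `D ≥ 1`, `p ∤ D`; Hecke at `r = p/D`:
`0 = [1/D]⁺ + Σ_{0<j<p} [(p+jD)/(pD)]⁺ + [p²/D]⁺`, the `p+1` Bézout matrices have `d`-entries `D, pD, …, pD, D`
(all `≡ u` modulo `⟨p⟩`), so `Σ k = −K₀ ≡ 0` reads `(p+1)·χ(u) = 0`, i.e. `χ(u) = 0`. (vii) Hence `ψ = 0`, every
`k_γ ∈ pℤ`, and by closure induction every period has real part in `pℤ·Ω⁺/2` — contradicting `Ω⁺/2 ∈ re Λ_f`. ∎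

HONEST SCOPE: LEMMA′ is a HYPOTHESIS (paper proof by the ideator from PUBLISHED group theory; typing it needs `SL₂(ℤ[1/p])`
vocabulary: cost ≈ L). Nothing else is assumed; no new named fact; no stub is closed by this file alone; crux 4 OPEN; BSD is not
proved by any of this.

References: [MazurTateTeitelbaum1986Invent] §I.4 (4.2), §I.8; [Manin1972] Prop. 1.4, Thm. 1.6; [CremonaAlgorithms1997] §2.1, §2.8
(2.8.8); [PollackWeston2011] Thm. 4.1 (1), Rem. 4.2; [Venkataramana1994] Thm. (p. 194); [Serre1970CSP]; tree
`PAdicLFunctionIntegralityProofs`, `PAdicLFunctionDistributionProofs`, `ModularSymbolsProofs`, `…SmallImageOrbitSumMuThree`.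
-/

set_option linter.dupNamespace false
set_option autoImplicit false

noncomputable section

open scoped Classical MatrixGroups ModularForm

open CongruenceSubgroup Literature.NumberTheory.EllipticCurves Literature.NumberTheory.EllipticCurves.ModularForms

namespace Summit.BirchSwinnertonDyer.BirchSwinnertonDyer.Theorems.SmallImageHeckePrimeMu

variable {N : ℕ} [NeZero N] (f : CuspForm (Gamma0 N) 2)

variable {p : ℕ} [Fact p.Prime]

/-! ## §5 LEMMA′(N,p) ⇒ NOT every `[a/p^k]⁺_f` vanishes mod `p` -/

/-- **THEOREM B of `EG-REDUCTION-g8` in the kernel, modulo LEMMA′.** Let `f` be a rational weight-2 newform of level `N`,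
`p` an odd prime, `p ∤ N`, `a_p(f) = 0`. ASSUME LEMMA′(N,p): every homomorphism `ψ : Γ₀(N) → ℤ/p` killing
`S_p = {γ : d(γ) = ±p^k}` is `χ(d(γ) mod N)` for a homomorphism `χ : (ℤ/N)ˣ → ℤ/p` trivial on `p` (group theory of
`Γ₀(N) ⊂ SL₂(ℤ[1/p])`: Venkataramana 1994 / Vaserstein 1972 + Mennicke 1967 / Serre 1970, paper proof `EG-REDUCTION-g8` §2–3;
a HYPOTHESIS here). THEN some plus symbol `[a/p^k]⁺_f` (`k ≥ 1`, `p ∤ a`) is a `p`-adic UNIT. Proof: otherwise the integer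
coordinates `k_γ` of the periods (`re {∞, γ∞}_f = k_γ Ω⁺_f/2`) give `ψ = k_γ mod p`, which kills `S_p` by Manin's relation
(`2([b/d]⁺ − [0]⁺) = k_γ`, `d = ±p^k`) — `[0]⁺ ≡ 0` by the Hecke relation at `r = 0` —; so `ψ = χ ∘ d`; the Hecke relation at
`r = p/D` (`a_p = 0`) reads `k_{1/D} + Σ_{0<j<p} k_{(p+jD)/(pD)} + k_{p²/D} = −2(p+1)[0]⁺ ≡ 0`, whose Bézout matrices have
`d`-entries `D, pD, …, pD, D`, so `(p+1)·χ(D̄) = 0`, `χ = 0`, `ψ = 0`, every `k_γ ≡ 0 (mod p)` — contradicting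
`re Λ_f = ℤ·Ω⁺_f/2` (`realPeriods_eq_zmultiples_of_plusPeriod_ne_zero`). With `…SmallImageOrbitSumMuThree` (p636964) this closes
`stub_muOneSign_ns_three` modulo LEMMA′(N_E, 3). [cite: MazurTateTeitelbaum1986Invent, §I.4 (4.2) and §I.8]
[cite: Manin1972, Prop. 1.4 and Thm. 1.6] [cite: CremonaAlgorithms1997, §2.8 (2.8.8)] -/
theorem exists_norm_ratPlusSymbol_eq_one_of_lemmaPrime (hp2 : p ≠ 2) (hf0 : IsNewform0 f) (hQ : coeffField f = ⊥)
    (hpN : ¬ p ∣ N) (hap : cuspCoeff f p = ((0 : ℤ) : ℂ))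
    (hLemma : ∀ ψ : Gamma0 N →* Multiplicative (ZMod p),
      (∀ γ : Gamma0 N, (∃ k : ℕ, ((γ : SL(2, ℤ)) 1 1 : ℤ) = (p : ℤ) ^ k ∨ ((γ : SL(2, ℤ)) 1 1 : ℤ) = -((p : ℤ) ^ k)) →
        ψ γ = 1) →
      ∃ χ : (ZMod N)ˣ →* Multiplicative (ZMod p),
        (∀ u : (ZMod N)ˣ, (u : ZMod N) = (p : ZMod N) → χ u = 1) ∧
        ∀ (γ : Gamma0 N) (u : (ZMod N)ˣ), (u : ZMod N) = (((γ : SL(2, ℤ)) 1 1 : ℤ) : ZMod N) → ψ γ = χ u) :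
    ∃ (k : ℕ) (a : ℤ), 1 ≤ k ∧ IsCoprime a (p : ℤ) ∧
      ‖((ratPlusSymbol f ((a : ℚ) / (p : ℚ) ^ k) : ℚ) : ℚ_[p])‖ = 1 := by
  have hp : p.Prime := Fact.out
  haveI : NeZero p := ⟨hp.ne_zero⟩
  by_contra hH
  push Not at hH
  have hH' : ∀ (k : ℕ) (a : ℤ), 1 ≤ k → IsCoprime a (p : ℤ) →
      ‖((ratPlusSymbol f ((a : ℚ) / (p : ℚ) ^ k) : ℚ) : ℚ_[p])‖ < 1 := fun k a hk ha ↦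
    lt_of_le_of_ne (norm_ratPlusSymbol_intCast_div_pow_le_one f hp2 hf0 hpN hap a k) (hH k a hk ha)
  -- periods and the integer coordinates `κ γ`
  set Ω := plusPeriod f with hΩdef
  have hΩpos : 0 < Ω := IsNewform0.plusPeriod_pos_holds hf0 hQ
  have hΩ2 : (Ω / 2 : ℝ) ≠ 0 := by positivity
  obtain ⟨hre, -⟩ := realPeriods_eq_zmultiples_of_plusPeriod_ne_zero f hΩpos.ne'
  choose κ hκ using exists_re_cuspSymbol_eq f hf0 hQ
  have hκ_unique : ∀ (γ : Gamma0 N) (k : ℤ), (cuspSymbol f γ).re = k * (Ω / 2) → κ γ = k := by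
    intro γ k hk
    have h : (κ γ : ℝ) * (Ω / 2) = k * (Ω / 2) := by rw [← hκ γ, hk]
    exact_mod_cast mul_right_cancel₀ hΩ2 h
  have hκ_mul : ∀ γ δ : Gamma0 N, κ (γ * δ) = κ γ + κ δ := by
    intro γ δ
    apply hκ_unique
    rw [cuspSymbol_mul_holds f γ δ, Complex.add_re, hκ γ, hκ δ]
    push_cast
    ring
  have hκ_one : κ 1 = 0 := by
    apply hκ_unique
    simp
  have hrat : ∀ r : ℚ, (ratPlusSymbol f r : ℝ) = normalizedPlusSymbol f r :=
    fun r ↦ ratCast_ratPlusSymbol_holds hf0 hQ r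
  -- `[0]⁺ ≡ 0` and the Eisenstein integer `K₀ = 2(p+1)[0]⁺ ≡ 0 (mod p)`
  have h0lt : ‖((ratPlusSymbol f 0 : ℚ) : ℚ_[p])‖ < 1 :=
    norm_ratPlusSymbol_zero_lt_one f hp2 hf0 hQ hpN hap (fun a ha ↦ hH' 1 a le_rfl ha)
  obtain ⟨K₀, hK₀⟩ := exists_intCast_eq_two_mul_mul_ratPlusSymbol_zero f hf0 hQ hpN hap
  have hK₀p : (K₀ : ZMod p) = 0 := by
    apply intCast_zmod_eq_zero_of_norm_lt_one
    have heq : ((K₀ : ℚ) : ℚ_[p]) = (((2 * ((p : ℤ) + 1) : ℤ) : ℚ) : ℚ_[p]) * ((ratPlusSymbol f 0 : ℚ) : ℚ_[p]) := by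
      rw [hK₀]
      push_cast
      ring
    rw [heq, norm_mul, Rat.cast_intCast]
    exact mul_lt_one_of_nonneg_of_lt_one_right (Padic.norm_int_le_one _) (norm_nonneg _) h0lt
  -- symbol differences are `p`-adically small under `hH'`
  have hsmall : ∀ {x : ℚ} {k : ℤ}, 2 * (ratPlusSymbol f x - ratPlusSymbol f 0) = k →
      ‖((ratPlusSymbol f x : ℚ) : ℚ_[p])‖ < 1 → (k : ZMod p) = 0 := by
    intro x k h2 hx
    apply intCast_zmod_eq_zero_of_norm_lt_one
    rw [← h2]
    push_cast
    rw [norm_mul]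
    refine mul_lt_one_of_nonneg_of_lt_one_right ?_ (norm_nonneg _) ?_
    · exact_mod_cast Padic.norm_int_le_one (p := p) 2
    · calc ‖((ratPlusSymbol f x : ℚ) : ℚ_[p]) - ((ratPlusSymbol f 0 : ℚ) : ℚ_[p])‖
          ≤ max ‖((ratPlusSymbol f x : ℚ) : ℚ_[p])‖ ‖-((ratPlusSymbol f 0 : ℚ) : ℚ_[p])‖ := by
            rw [sub_eq_add_neg]
            exact IsUltrametricDist.norm_add_le_max _ _
        _ < 1 := by rw [norm_neg]; exact max_lt hx h0lt
  -- the homomorphism `ψ = κ mod p`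
  let ψ : Gamma0 N →* Multiplicative (ZMod p) :=
    { toFun := fun γ ↦ Multiplicative.ofAdd (((κ γ : ℤ) : ZMod p))
      map_one' := by simp [hκ_one]
      map_mul' := fun γ δ ↦ by simp [hκ_mul, ofAdd_add] }
  have hψ : ∀ γ, ψ γ = Multiplicative.ofAdd (((κ γ : ℤ) : ZMod p)) := fun γ ↦ rfl
  -- `ψ` kills `S_p`
  have hkill : ∀ γ : Gamma0 N,
      (∃ k : ℕ, ((γ : SL(2, ℤ)) 1 1 : ℤ) = (p : ℤ) ^ k ∨ ((γ : SL(2, ℤ)) 1 1 : ℤ) = -((p : ℤ) ^ k)) → ψ γ = 1 := by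
    rintro γ ⟨k, hk⟩
    rw [hψ, ← ofAdd_zero]
    congr 1
    set b : ℤ := ((γ : SL(2, ℤ)) 0 1 : ℤ) with hb
    set d : ℤ := ((γ : SL(2, ℤ)) 1 1 : ℤ) with hd
    have hpk : ((p : ℤ) ^ k) ≠ 0 := pow_ne_zero _ (by exact_mod_cast hp.ne_zero)
    have hd0 : d ≠ 0 := by
      rcases hk with h | h
      · rw [h]; exact hpk
      · rw [h]; exact neg_ne_zero.mpr hpk
    have hne : (((γ : SL(2, ℤ)) 1 0 : ℤ) : ℚ) * 0 + (((γ : SL(2, ℤ)) 1 1 : ℤ) : ℚ) ≠ 0 := by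
      rw [mul_zero, zero_add]
      exact_mod_cast hd0
    have hManin := modularSymbol_gamma0_smul_holds f γ 0 hne
    rw [mul_zero, zero_add, mul_zero, zero_add] at hManin
    have h2 := two_mul_sub_eq_of_manin f hf0 hQ hManin (hκ γ)
    refine hsmall h2 ?_
    rcases Nat.eq_zero_or_pos k with rfl | hkpos
    · -- `d = ±1`: the cusp `b/d` is an integer, `[b/d]⁺ = [0]⁺`
      have hint : ∃ n : ℤ, ((((γ : SL(2, ℤ)) 0 1 : ℤ) : ℚ)) / ((((γ : SL(2, ℤ)) 1 1 : ℤ) : ℚ)) = (0 : ℚ) + n := by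
        rcases hk with h | h
        · refine ⟨b, ?_⟩
          rw [← hd, h, pow_zero]; push_cast; ring
        · refine ⟨-b, ?_⟩
          rw [← hd, h, pow_zero]; push_cast; ring
      obtain ⟨n, hn⟩ := hint
      rw [hn, ratPlusSymbol_add_intCast_eq]
      exact h0lt
    · -- `d = ±p^k`, `k ≥ 1`: `b` is prime to `p`, and `b/d = (±b)/p^k`
      have hbd : IsCoprime b d := Matrix.SpecialLinearGroup.isCoprime_col (γ : SL(2, ℤ)) 1
      have hpd : (p : ℤ) ∣ d := by
        rcases hk with h | h
        · rw [h]; exact dvd_pow_self _ hkpos.ne'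
        · rw [h]; exact (dvd_pow_self _ hkpos.ne').neg_right
      have hbp : IsCoprime b (p : ℤ) := hbd.of_isCoprime_of_dvd_right hpd
      rcases hk with h | h
      · have heq : ((((γ : SL(2, ℤ)) 0 1 : ℤ) : ℚ)) / ((((γ : SL(2, ℤ)) 1 1 : ℤ) : ℚ)) = (b : ℚ) / (p : ℚ) ^ k := by
          rw [← hb, ← hd, h]; push_cast; ring
        rw [heq]
        exact hH' k b hkpos hbp
      · have heq : ((((γ : SL(2, ℤ)) 0 1 : ℤ) : ℚ)) / ((((γ : SL(2, ℤ)) 1 1 : ℤ) : ℚ)) = ((-b : ℤ) : ℚ) / (p : ℚ) ^ k := by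
          rw [← hb, ← hd, h]; push_cast; field_simp
        rw [heq]
        exact hH' k (-b) hkpos hbp.neg_left
  obtain ⟨χ, hχp, hχ⟩ := hLemma ψ hkill
  -- `χ = 1`: the Hecke relation at `r = p/D`
  have hχ1 : ∀ u : (ZMod N)ˣ, χ u = 1 := by
    intro u
    -- an integer `D ≥ 1` with `D ≡ u (mod N)` and `p ∤ D`
    obtain ⟨D, hD1, hDu, hpD⟩ : ∃ D : ℕ, 1 ≤ D ∧ ((D : ℕ) : ZMod N) = (u : ZMod N) ∧ ¬ p ∣ D := by
      by_cases hdiv : p ∣ (u : ZMod N).val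
      · refine ⟨(u : ZMod N).val + N, ?_, ?_, ?_⟩
        · have := Nat.pos_of_neZero N
          omega
        · push_cast
          rw [ZMod.natCast_zmod_val, ZMod.natCast_self, add_zero]
        · intro h
          exact hpN ((Nat.dvd_add_right hdiv).mp h)
      · exact ⟨(u : ZMod N).val, Nat.pos_of_ne_zero (fun h0 ↦ hdiv (h0 ▸ dvd_zero p)),
          ZMod.natCast_zmod_val _, hdiv⟩
    have hDN : Nat.Coprime D N := (ZMod.isUnit_iff_coprime D N).mp (hDu ▸ Units.isUnit u)
    have hpDcop : Nat.Coprime p D := (hp.coprime_iff_not_dvd).mpr hpD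
    have hpNcop : Nat.Coprime p N := (hp.coprime_iff_not_dvd).mpr hpN
    have hD0 : (D : ℤ) ≠ 0 := by exact_mod_cast (show D ≠ 0 by omega)
    have hpD0 : ((p : ℤ) * D) ≠ 0 := mul_ne_zero (by exact_mod_cast hp.ne_zero) hD0
    -- coprimality of the three denominators with `numerator · N`
    have hcop0 : IsCoprime (D : ℤ) ((1 : ℤ) * N) := by
      rw [one_mul]; exact Nat.isCoprime_iff_coprime.mpr hDN
    have hcop' : IsCoprime (D : ℤ) ((p : ℤ) ^ 2 * N) := by
      have h1 : Nat.Coprime D (p ^ 2 * N) := Nat.Coprime.mul_right (Nat.Coprime.pow_right 2 hpDcop.symm) hDN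
      have h := Nat.isCoprime_iff_coprime.mpr h1
      push_cast at h
      exact h
    have hcopj : ∀ j : Fin p, j ≠ 0 → IsCoprime ((p : ℤ) * D) (((p : ℤ) + ((j : ℕ) : ℤ) * D) * N) := by
      intro j hj0
      have hjp : ¬ p ∣ (j : ℕ) := fun h ↦ hj0 (Fin.ext (by
        rw [Fin.val_zero]
        exact Nat.eq_zero_of_dvd_of_lt h j.isLt))
      have h1 : Nat.Coprime p (p + (j : ℕ) * D) := by
        rw [add_comm, Nat.coprime_add_self_right]
        exact Nat.Coprime.mul_right ((hp.coprime_iff_not_dvd).mpr hjp) hpDcop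
      have h2 : Nat.Coprime D (p + (j : ℕ) * D) := (Nat.coprime_add_mul_right_right D p (j : ℕ)).mpr hpDcop.symm
      have h3 : Nat.Coprime (p * D) ((p + (j : ℕ) * D) * N) :=
        Nat.Coprime.mul_right (Nat.Coprime.mul_left h1 h2) (Nat.Coprime.mul_left hpNcop hDN)
      have h := Nat.isCoprime_iff_coprime.mpr h3
      push_cast at h
      exact h
    -- the Bézout matrices of the `p + 1` cusps
    obtain ⟨γ₀, k₀, hγ₀, hk₀, h2₀⟩ := exists_gamma0_two_mul_sub_eq f hf0 hQ (B := 1) hD0 hcop0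
    obtain ⟨γ', k', hγ', hk', h2'⟩ := exists_gamma0_two_mul_sub_eq f hf0 hQ (B := (p : ℤ) ^ 2) hD0 hcop'
    have hsj : ∀ j : Fin p, j ≠ 0 → ∃ (γ : Gamma0 N) (k : ℤ), ((γ : SL(2, ℤ)) 1 1 : ℤ) = (p : ℤ) * D ∧
        (cuspSymbol f γ).re = k * (plusPeriod f / 2) ∧
        2 * (ratPlusSymbol f ((((p : ℤ) + ((j : ℕ) : ℤ) * D : ℤ) : ℚ) / (((p : ℤ) * D : ℤ) : ℚ)) -
          ratPlusSymbol f 0) = k :=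
      fun j hj0 ↦ exists_gamma0_two_mul_sub_eq f hf0 hQ hpD0 (hcopj j hj0)
    choose! γj kj hγj hkj h2j using hsj
    -- their `ψ`-values all equal `χ u`
    set c : ZMod p := Multiplicative.toAdd (χ u) with hc
    have hval : ∀ (γ : Gamma0 N) (k : ℤ), (cuspSymbol f γ).re = k * (plusPeriod f / 2) → ψ γ = χ u →
        (k : ZMod p) = c := by
      intro γ k hk hψγ
      rw [← hκ_unique γ k hk, hc, ← hψγ, hψ, toAdd_ofAdd]
    have hc₀ : (k₀ : ZMod p) = c := hval γ₀ k₀ hk₀ (hχ γ₀ u (by rw [hγ₀]; push_cast; exact hDu.symm))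
    have hc' : (k' : ZMod p) = c := hval γ' k' hk' (hχ γ' u (by rw [hγ']; push_cast; exact hDu.symm))
    have hpDN : Nat.Coprime (p * D) N := Nat.Coprime.mul_left hpNcop hDN
    have hcj : ∀ j : Fin p, j ≠ 0 → (kj j : ZMod p) = c := by
      intro j hj0
      refine hval (γj j) (kj j) (hkj j hj0) ?_
      have hw : ((ZMod.unitOfCoprime (p * D) hpDN : (ZMod N)ˣ) : ZMod N) = (((γj j : SL(2, ℤ)) 1 1 : ℤ) : ZMod N) := by
        rw [ZMod.coe_unitOfCoprime, hγj j hj0]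
        push_cast
        rfl
      rw [hχ (γj j) _ hw]
      have hwu : ZMod.unitOfCoprime (p * D) hpDN = ZMod.unitOfCoprime p hpNcop * u := by
        ext
        rw [ZMod.coe_unitOfCoprime, Units.val_mul, ZMod.coe_unitOfCoprime, ← hDu]
        push_cast
        rfl
      rw [hwu, map_mul, hχp _ (ZMod.coe_unitOfCoprime p hpNcop), one_mul]
    -- the Hecke relation at `r = p/D`, `a_p = 0`
    have hH := intCast_mul_ratPlusSymbol p hf0 hp hpN hap hrat ((p : ℚ) / D)
    rw [Int.cast_zero, zero_mul, ← Finset.add_sum_erase _ _ (Finset.mem_univ (0 : Fin p))] at hH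
    have hDq : (D : ℚ) ≠ 0 := by exact_mod_cast (show D ≠ 0 by omega)
    have hpq : (p : ℚ) ≠ 0 := by exact_mod_cast hp.ne_zero
    have ht0 : ratPlusSymbol f (((p : ℚ) / D + (((0 : Fin p) : ℕ) : ℚ)) / p) =
        ratPlusSymbol f (((1 : ℤ) : ℚ) / ((D : ℤ) : ℚ)) := by
      congr 1
      rw [Fin.val_zero]
      push_cast
      field_simp
      ring
    have ht' : ratPlusSymbol f ((p : ℚ) * ((p : ℚ) / D)) =
        ratPlusSymbol f ((((p : ℤ) ^ 2 : ℤ) : ℚ) / ((D : ℤ) : ℚ)) := by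
      congr 1
      push_cast
      ring
    have htj : ∀ j ∈ (Finset.univ : Finset (Fin p)).erase 0,
        ratPlusSymbol f (((p : ℚ) / D + ((j : ℕ) : ℚ)) / p) =
          (kj j : ℚ) / 2 + ratPlusSymbol f 0 := by
      intro j hj
      have hj0 : j ≠ 0 := Finset.ne_of_mem_erase hj
      have heq : ((p : ℚ) / D + ((j : ℕ) : ℚ)) / p =
          ((((p : ℤ) + ((j : ℕ) : ℤ) * D : ℤ) : ℚ) / (((p : ℤ) * D : ℤ) : ℚ)) := by
        push_cast
        field_simp
      rw [heq]
      have h := h2j j hj0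
      linarith
    rw [ht0, ht', Finset.sum_congr rfl htj, Finset.sum_add_distrib, Finset.sum_const,
      Finset.card_erase_of_mem (Finset.mem_univ _), Finset.card_univ, Fintype.card_fin, nsmul_eq_mul,
      ← Finset.sum_div] at hH
    -- integer identity: `k₀ + Σ kj + k' = −K₀`
    have hint : ((k₀ + ∑ j ∈ (Finset.univ : Finset (Fin p)).erase 0, kj j + k' : ℤ) : ℚ) = -K₀ := by
      push_cast
      rw [hK₀]
      have hp1 : ((p - 1 : ℕ) : ℚ) = (p : ℚ) - 1 := by rw [Nat.cast_sub hp.one_lt.le, Nat.cast_one]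
      rw [hp1] at hH
      linarith
    have hintZ : k₀ + ∑ j ∈ (Finset.univ : Finset (Fin p)).erase 0, kj j + k' = -K₀ := by exact_mod_cast hint
    -- reduce mod `p`: `c + (p−1)c + c = 0`, i.e. `c = 0`
    have hmod := congr_arg (fun z : ℤ ↦ (z : ZMod p)) hintZ
    simp only [Int.cast_add, Int.cast_sum, Int.cast_neg, hK₀p, neg_zero, hc₀, hc'] at hmod
    rw [Finset.sum_congr rfl (fun j hj ↦ hcj j (Finset.ne_of_mem_erase hj)), Finset.sum_const,
      Finset.card_erase_of_mem (Finset.mem_univ _), Finset.card_univ, Fintype.card_fin, nsmul_eq_mul] at hmod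
    have hp1 : ((p - 1 : ℕ) : ZMod p) = -1 := by
      rw [Nat.cast_sub hp.one_lt.le, Nat.cast_one, ZMod.natCast_self, zero_sub]
    rw [hp1] at hmod
    have hc0 : c = 0 := by linear_combination hmod
    rw [← ofAdd_toAdd (χ u), ← hc, hc0, ofAdd_zero]
  -- hence every `κ γ` is divisible by `p`
  have hκp : ∀ γ : Gamma0 N, (p : ℤ) ∣ κ γ := by
    intro γ
    have hdet := Matrix.SpecialLinearGroup.det_coe (γ : SL(2, ℤ))
    rw [Matrix.det_fin_two] at hdet
    have hc0 : ((((γ : SL(2, ℤ)) 1 0 : ℤ)) : ZMod N) = 0 := Gamma0_mem.mp γ.2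
    have hunit : IsUnit ((((γ : SL(2, ℤ)) 1 1 : ℤ) : ZMod N)) := by
      refine IsUnit.of_mul_eq_one ((((γ : SL(2, ℤ)) 0 0 : ℤ) : ZMod N)) ?_
      have h := congr_arg (fun z : ℤ ↦ (z : ZMod N)) hdet
      simp only [Int.cast_sub, Int.cast_mul, Int.cast_one, hc0, mul_zero, sub_zero] at h
      rw [mul_comm]
      exact h
    obtain ⟨u, hu⟩ := hunit
    have h := hχ γ u hu
    rw [hχ1 u, hψ, ← ofAdd_zero] at h
    have h0 : (((κ γ : ℤ)) : ZMod p) = 0 := Multiplicative.ofAdd.injective h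
    exact (ZMod.intCast_zmod_eq_zero_iff_dvd _ _).mp h0
  -- contradiction with `re Λ_f = ℤ · Ω⁺/2`
  have hmem : (Ω / 2 : ℝ) ∈ realPeriods f := by
    rw [hre]
    exact AddSubgroup.mem_zmultiples _
  obtain ⟨z, hz, hzre⟩ := AddSubgroup.mem_map.mp hmem
  have hall : ∀ z ∈ periodLattice f, ∃ m : ℤ, z.re = m * (Ω / 2) ∧ (p : ℤ) ∣ m := by
    intro z hz
    refine AddSubgroup.closure_induction (p := fun z _ ↦ ∃ m : ℤ, z.re = m * (Ω / 2) ∧ (p : ℤ) ∣ m)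
      ?_ ?_ ?_ ?_ hz
    · rintro x ⟨γ, rfl⟩
      exact ⟨κ γ, hκ γ, hκp γ⟩
    · exact ⟨0, by simp, dvd_zero _⟩
    · rintro x y - - ⟨m₁, hm₁, hd₁⟩ ⟨m₂, hm₂, hd₂⟩
      exact ⟨m₁ + m₂, by rw [Complex.add_re, hm₁, hm₂]; push_cast; ring, dvd_add hd₁ hd₂⟩
    · rintro x - ⟨m, hm, hd⟩
      exact ⟨-m, by rw [Complex.neg_re, hm]; push_cast; ring, (dvd_neg).mpr hd⟩
  obtain ⟨m, hm, hpm⟩ := hall z hz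
  have hzre' : z.re = Ω / 2 := hzre
  have hm1 : (m : ℝ) = 1 := by
    have h : (m : ℝ) * (Ω / 2) = 1 * (Ω / 2) := by rw [← hm, hzre', one_mul]
    exact mul_right_cancel₀ hΩ2 h
  have hm1' : m = 1 := by exact_mod_cast hm1
  rw [hm1'] at hpm
  exact hp.one_lt.ne' (by exact_mod_cast Int.eq_one_of_dvd_one (by positivity) hpm)

end Summit.BirchSwinnertonDyer.BirchSwinnertonDyer.Theorems.SmallImageHeckePrimeMu

end
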